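import Mathlib
import Literature.Computability.Complexity.Classes
import Literature.Computability.Complexity.Nondeterministic
import Literature.Computability.Complexity.Randomized
import Literature.Computability.MetaComplexity.ChenJinSanthanamWilliams2022.MCSPRefuterMagnification
import Literature.Computability.MetaComplexity.Fu2020.RandomizedStreamingMagnification
import HarnessLib

/-!
# Chen–Jin–Santhanam–Williams (FOCS 2021), Theorem 1.4: polylogtime-uniform-`AC⁰` REFUTERS for
# Set-Disjointness against small-space randomized STREAMING algorithms magnify to `P ≠ NP`
# (magnification-gap census row R36, threshold side)

Topic `Literature/Computability/MetaComplexity`, directory `ChenJinSanthanamWilliams2022/`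
(bib key `ChenEtAl2022`: L. Chen, C. Jin, R. Santhanam, R. Williams, *Constructive separations
and their consequences*, FOCS 2021 (IEEE 2022) pp. 646–657 = arXiv:2203.14379 = TheoretiCS 3
(2024)).  Companion of `MCSPRefuterMagnification.lean` (Thm. 1.7, row R38), whose uniform-`AC⁰`
printing families `IsUniformAC0Family` / `printed` (address form: the circuit `C k` reads a
`k`-bit address and the family PRINTS the `2^k`-bit string `printed C k`) are reused, and of
`QueryRefuterMagnification.lean` (Thm. 1.6, row R37).  The refuted algorithms are the tree's
RANDOMIZED ONE-PASS STREAMING ALGORITHMS `Fu2020.RStreamingAlgorithm` (update map fed fresh coins,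
report map, runs `reach` / `acceptsWith`, space on runs `RunsInSpace`; `Fu2020/`).  Locators are
chunk:line of the held LaTeX-source text `paper:arxiv-2203.14379`; theorem numbers are those of
the FOCS / arXiv version (Def. 1.1, Thm. 1.2 = `theo:refuter-uniform-sep`, Thm. 1.3 = `theo:PNP…`,
Thm. 1.4 = `theo:uniformAC0-constructive-to-PNP-lowb`).

## The printed statements (verbatim)

* The problem (p0005 L3): "Recall in the `DISJ` problem, Alice is given an `n`-bit string `x`,
  Bob is given an `n`-bit string `y`, and the goal is to determine whether their inner product
  `Σ_{i=1}^n x_i y_i` is nonzero."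
* The known, NON-constructive lower bound (K side of the census row; NOT typed here, see (v)):
  (p0005 L3) "from the randomized communication lower bound for the Set-Disjointness (`DISJ`)
  problem [KS92, Raz92, BJKS04], it follows that no `n^{1−ε}`-space randomized streaming
  algorithm can solve `DISJ` on `2n` input bits."; (p0005 L25) "To recap, it is well-known that
  `DISJ` does not have randomized streaming algorithms with `O(n · (log n)^{f(n)})` time and
  `O(log n)^{f(n)}` space, even for `f(n) ≤ o(log n / log log n)`, by communication complexity
  arguments. We are saying that, if (given the code of such an algorithm) we can efficiently
  construct hard instances of `DISJ` for that algorithm, then strong lower bounds follow."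
* Refuters against streaming algorithms (p0005 L21): "Similarly to (Definition 1.1), we can
  consider polylogtime-uniform-`AC⁰`-refuters against streaming algorithms, which are
  polylogtime-uniform-`AC⁰` circuits that output counterexamples for streaming algorithms on
  infinitely many input lengths."  Def. 1.1 (p0003 L19–40): the refuter "prints a string
  `x ∈ {0,1}ⁿ`, such that for infinitely many `n`, `A(x) ≠ f(x)`"; a `𝒟`-constructive separation
  of `f ∉ 𝒞` = "for every algorithm `A` computable in `𝒞`, there is a refuter for `f` against
  `A` that is computable in `𝒟`"; randomized `A` are taken "with bounded probability gap […] we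
  denote this answer `b` by `A(x)`".
* Thm. 1.4 (p0005 L23): "Let `f(n) ≥ ω(1)`. A polylogtime-uniform-`AC⁰`-constructive separation
  of `DISJ` from randomized streaming algorithms with `O(n · (log n)^{f(n)})` time and
  `O(log n)^{f(n)}` space implies `P ≠ NP`."  Proof (§3.2, p0012 L37): "We prove the
  contrapositive. Assuming `P = NP`, we will show that there is an efficient streaming algorithm
  that solves all disjointness instances that are generated by polylogtime-uniform `AC⁰` circuit
  families." — here `n` is the length of the whole input stream (p0012 L41–43: "`DISJ` on any
  `n`-bit input", "a streaming algorithm in `n · (log n)^{kc}` time and `O(log n)^{kc}` space").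

## Rendering notes (F-rules: the typed HYPOTHESIS implies the printed hypothesis, so the printed
## theorem implies the typed fact `thm14`)

(i) THE LANGUAGE.  A stream `w ∈ {0,1}^N` is read as `x = w[0, N/2)`, `y = w[N/2, N)` (for odd
`N` the middle conventions are immaterial: refuters print strings of length `2^k`), and
`w ∈ DISJ` iff the inner product is nonzero, i.e. some `i < N/2` has `xᵢ = yᵢ = 1`
(`disjAnswer w = true`), literally as quoted; the complementary convention ("disjoint") changes
nothing below, the refuted class being closed under negating the report.
(ii) THE REFUTED CLASS is ENLARGED to `PolylogSpaceStreaming f` = ALL `Fu2020.RStreamingAlgorithm`s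
whose stored state between two input bits has at most `c · (log₂ N)^{f(N)} + c` bits on every run
(`RunsInSpace`), for some constant `c`: the printed TIME bound `O(n (log n)^{f(n)})`, the
UNIFORMITY of the algorithm and the bounded-probability-gap convention are all DROPPED (each
omission enlarges the class).  Every printed algorithm `B` (a uniform randomized one-pass machine
with working storage `O((log n)^{f(n)})` and total time `T(n) = O(n (log n)^{f(n)})`) IS such an
object with the same acceptance probabilities: take `updCoins N = repCoins N = T(N)` (an upper
bound on all coins `B` can toss), let the update map run `B` from its stored configuration
(memory image, `≤ c (log N)^{f(N)} + c` bits) until it requests the next input bit, answering its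
coin requests from the fresh block, and let the report map finish the run; since every requested
coin is a fresh uniform bit, `acceptsWith w ·` under a uniform coin string has exactly `B`'s
output distribution on `w`.  Hence a typed constructive separation (a refuter against EVERY member
of the larger class) is in particular a printed one, for the same `f`.  (If `n` in the printed
space bound were read as the half-length `N/2`, the printed class for `f` is contained in the
typed class for `N ↦ f(⌊N/2⌋)`, again a function tending to infinity; `thm14` quantifies over all
such `f`.)  The growth condition "`f(n) ≥ ω(1)`" is `Tendsto f atTop atTop`, with no
constructivity assumption, as printed.
(iii) FAILURE AND REFUTERS.  "`A(x) ≠ DISJ(x)`" for randomized `A` is rendered, as in row R37,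
by: under a uniformly random coin string of the run's length (the tree's `uniformProb`), `A`'s
verdict equals `DISJ(x)` with probability `< 2/3` (`DisjFailsOn`).  For the printed, bounded-gap
algorithms this IS "`A(x) ≠ DISJ(x)`" (the `2/3`-majority answer `A(x)` differs from `DISJ(x)` iff
the correct verdict has probability `< 2/3`), and only printed algorithms matter for the direction
of the implication.  A refuter is a `P`-DCL-uniform (the tree's reading of polylogtime-uniform,
`IsUniformAC0Family`) `AC⁰` family of polynomial size `2^{c k + c} = 2^c · N^c` printing, for
infinitely many `k`, a `2^k`-bit stream on which `A` fails (`IsDisjRefuterAgainst`,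
`HasDisjAC0Refuter`); printed refuters need only succeed on infinitely many lengths, so a typed
refuter (lengths `N = 2^k`) is a printed one, and `P`-DCL-uniformity implies polylogtime-uniformity
as discussed in `MCSPRefuterMagnification.lean` (ii).
(iv) THE CONCLUSION is the tree's `Classes.P ≠ NP`.
(v) NOT TYPED: the K side.  The printed lower bound ("no `n^{1−ε}`-space randomized streaming
algorithm can solve `DISJ`") concerns the PRINTED notion of streaming algorithm; the tree's
`RStreamingAlgorithm` / `RunsInSpace` neither charges the update machine's scratch space nor
requires uniformity, so the literal transcription "`RunsInSpace (N/2)^{1−ε}` ⇒ `¬ DecidesBP DISJ`"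
would be a STRONGER statement than the printed sentence (it follows from the one-way
communication argument the sentence alludes to, but that derivation for this model is not in
print).  What IS proved here is the formal shape of the census gap: a refuter against `A` yields an
input on which `A` fails, so `HasDisjAC0Refuter A → ¬ A.DecidesBP DISJ`
(`not_decidesBP_of_hasDisjAC0Refuter`) — the threshold asks for the CONSTRUCTIVE form of a
separation whose non-constructive form is the known one.
(vi) PROVED CALIBRATION (rule F1): the class is inhabited for every `f` (`rejectAll_mem`); the
refuter condition is met against the always-reject algorithm by any family printing all-ones
strings of length `≥ 2` for all large `k` (`isDisjRefuterAgainst_rejectAll`); and NO family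
refutes the store-everything algorithm `storeAll`, which decides `DISJ` exactly and belongs to
`PolylogSpaceStreaming f` as soon as `(log₂ N)^{f(N)} ≥ N` for all large `N`
(`storeAll_mem`, `not_hasDisjAC0Refuter_storeAll`) — so for such fast `f` the hypothesis of
`thm14` is FALSE and the instance is vacuous (`not_forall_hasDisjAC0Refuter_of_fast`): the
content of Thm. 1.4 lies in the slow regime `(log N)^{f(N)} < N`, where the printed
communication-complexity bound says every member of the class fails somewhere.
-/

noncomputable section

open Computability Filter

namespace Literature.Computability.MetaComplexity.ChenJinSanthanamWilliams2022

open Literature.Computability.Complexity Literature.Computability.MetaComplexity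

/-! ### Set-Disjointness as a one-pass streaming problem (rendering note (i)) -/

/-- **The `DISJ` answer on a stream `w`**: with `x = w[0, N/2)` and `y = w[N/2, N)`, `N = |w|`,
`true` iff the inner product `Σ xᵢ yᵢ` is nonzero, i.e. some `i < N/2` has `w[i] = w[N/2+i] = 1`.
[cite: ChenEtAl2022, §1.2.2 (the DISJ problem, p.5)] -/
def disjAnswer (w : List Bool) : Bool :=
  (List.range (w.length / 2)).any fun i => w.getD i false && w.getD (w.length / 2 + i) false

/-- **`DISJ`** as a language of streams: `w ∈ DISJ` iff `disjAnswer w = true` ("determine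
whether their inner product is nonzero"). [cite: ChenEtAl2022, §1.2.2 (the DISJ problem, p.5)] -/
def DISJ : Language Bool := {w | disjAnswer w = true}

/-- Membership in `DISJ` is the Boolean answer. [folklore] -/
theorem mem_DISJ {w : List Bool} : w ∈ DISJ ↔ disjAnswer w = true := Iff.rfl

/-- A stream of length `≥ 2` all of whose bits are `1` is a YES instance (index `0`). [folklore] -/
theorem disjAnswer_of_all_true {w : List Bool} (hw : 2 ≤ w.length)
    (h : ∀ i : Fin w.length, w.get i = true) : disjAnswer w = true := by
  unfold disjAnswer
  rw [List.any_eq_true]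
  refine ⟨0, List.mem_range.2 (by omega), ?_⟩
  have h0 : w.getD 0 false = true := by
    rw [List.getD_eq_getElem _ _ (by omega)]
    exact h ⟨0, by omega⟩
  have h1 : w.getD (w.length / 2 + 0) false = true := by
    rw [List.getD_eq_getElem _ _ (by omega)]
    exact h ⟨w.length / 2 + 0, by omega⟩
  show (w.getD 0 false && w.getD (w.length / 2 + 0) false) = true
  rw [h0, h1]
  rfl

/-! ### Failure, the refuted class, refuters (rendering notes (ii)–(iii)) -/

/-- **`A` fails on the stream `w`** (as a `DISJ` algorithm): under a uniformly random coin string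
of the run's length, `A`'s verdict equals `DISJ(w)` with probability `< 2/3` (for bounded-gap `A`:
"`A(w) ≠ DISJ(w)`"). [cite: ChenEtAl2022, Def. 1.1 (A(x) ≠ f(x), bounded probability gap)] -/
def DisjFailsOn (A : Fu2020.RStreamingAlgorithm) (w : List Bool) : Prop :=
  uniformProb (A.coinLen w.length) {y | A.acceptsWith w y = disjAnswer w} < 2 / 3

/-- **The refuted class of Thm. 1.4, enlarged** (rendering note (ii)): randomized one-pass
streaming algorithms storing at most `c · (log₂ N)^{f(N)} + c` bits between input bits on every
run, for some constant `c` (no time bound, no uniformity, no gap condition).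
[cite: ChenEtAl2022, Thm. 1.4 (randomized streaming algorithms with O(log n)^{f(n)} space)] -/
def PolylogSpaceStreaming (f : ℕ → ℕ) : Set Fu2020.RStreamingAlgorithm :=
  {A | ∃ c : ℕ, A.RunsInSpace fun N => c * Nat.log 2 N ^ f N + c}

/-- **`C` refutes `A` on `DISJ`**: for infinitely many `k`, `A` fails on the printed `2^k`-bit
stream `printed C k` ("output counterexamples for streaming algorithms on infinitely many input
lengths", lengths `N = 2^k`). [cite: ChenEtAl2022, §1.2.2 (uniform-AC⁰ refuters against streaming algorithms, p.5)] -/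
def IsDisjRefuterAgainst (A : Fu2020.RStreamingAlgorithm) (C : CircuitFamily) : Prop :=
  ∃ᶠ k in atTop, DisjFailsOn A (printed C k)

/-- **There is a polylogtime-uniform `AC⁰` refuter for `DISJ` against `A`**: a `P`-DCL-uniform
`AC⁰` family of polynomial size `2^{c k + c} = 2^c · N^c` (D9's `IsUniformAC0Family`) refuting `A`.
[cite: ChenEtAl2022, Thm. 1.4 (hypothesis: polylogtime-uniform-AC⁰-constructive separation)] -/
def HasDisjAC0Refuter (A : Fu2020.RStreamingAlgorithm) : Prop :=
  ∃ c : ℕ, ∃ C : CircuitFamily,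
    IsUniformAC0Family (fun k => 2 ^ (c * k + c)) C ∧ IsDisjRefuterAgainst A C

/-! ### The named fact (T side of census row R36) -/

/-- **[CJSW21, Thm. 1.4].**  For every `f : ℕ → ℕ` tending to infinity: if EVERY randomized
one-pass streaming algorithm with stored state `O((log₂ N)^{f(N)})` admits a polynomial-size
polylogtime-uniform `AC⁰` family printing, for infinitely many `N = 2^k`, a stream on which it
fails as a `DISJ` algorithm, then `P ≠ NP`.  Printed (p0005 L23): "Let `f(n) ≥ ω(1)`. A
polylogtime-uniform-`AC⁰`-constructive separation of `DISJ` from randomized streaming algorithms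
with `O(n · (log n)^{f(n)})` time and `O(log n)^{f(n)}` space implies `P ≠ NP`."  Typed
hypothesis ⇒ printed hypothesis: rendering notes (ii)–(iii). [cite: ChenEtAl2022, Thm. 1.4] -/
def thm14 : Prop :=
  ∀ f : ℕ → ℕ, Tendsto f atTop atTop →
    (∀ A ∈ PolylogSpaceStreaming f, HasDisjAC0Refuter A) → Classes.P ≠ Nondeterministic.NP

/-! ### Proved: a refuter witnesses failure — the constructive form implies the non-constructive
one (rendering note (v)) -/

/-- If `A` fails on some stream then `A` does not decide `DISJ` with two-sided bounded error. [folklore] -/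
theorem not_decidesBP_of_disjFailsOn {A : Fu2020.RStreamingAlgorithm} {w : List Bool}
    (h : DisjFailsOn A w) : ¬ A.DecidesBP DISJ := by
  intro hD
  have hset : {y : List Bool | A.acceptsWith w y = true ↔ w ∈ DISJ} =
      {y : List Bool | A.acceptsWith w y = disjAnswer w} := by
    ext y
    simp only [Set.mem_setOf_eq, mem_DISJ]
    cases A.acceptsWith w y <;> cases disjAnswer w <;> simp
  have h23 := hD w
  rw [hset] at h23
  exact absurd h (not_lt.2 h23)

/-- **Constructive ⇒ non-constructive**: a (uniform `AC⁰`) refuter against `A` exhibits streams on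
which `A` fails, so `A` does not decide `DISJ` with bounded error — the typed shape of the census
gap for row R36 (the threshold is the constructive form of a separation known non-constructively).
[folklore] -/
theorem not_decidesBP_of_hasDisjAC0Refuter {A : Fu2020.RStreamingAlgorithm}
    (h : HasDisjAC0Refuter A) : ¬ A.DecidesBP DISJ := by
  obtain ⟨_, C, _, hC⟩ := h
  obtain ⟨k, hk⟩ := hC.exists
  exact not_decidesBP_of_disjFailsOn hk

/-! ### Proved: the class and the refuter condition are inhabited (rendering note (vi)) -/

/-- **The refuted class is inhabited** for every `f`: the always-reject algorithm stores nothing.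
[folklore] -/
theorem rejectAll_mem (f : ℕ → ℕ) : Fu2020.Trivial.rejectAll ∈ PolylogSpaceStreaming f :=
  ⟨0, fun N x y _ _ => by simp⟩

/-- The always-reject algorithm fails on every YES stream. [folklore] -/
theorem disjFailsOn_rejectAll {w : List Bool} (hw : disjAnswer w = true) :
    DisjFailsOn Fu2020.Trivial.rejectAll w := by
  unfold DisjFailsOn
  have hset : {y : List Bool | Fu2020.Trivial.rejectAll.acceptsWith w y = disjAnswer w} = ∅ := by
    ext y
    simp [hw]
  rw [hset, uniformProb_empty]
  norm_num

/-- **The refuter condition is met** against the always-reject algorithm by ANY family that, for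
all large `k`, prints an all-ones stream of length `≥ 2` (a YES instance of `DISJ`); uniformity of
such a family (one `∧₀` gate) is standard and not constructed here. [folklore] -/
theorem isDisjRefuterAgainst_rejectAll {C : CircuitFamily}
    (h : ∀ᶠ k in atTop, 2 ≤ (printed C k).length ∧
      ∀ i : Fin (printed C k).length, (printed C k).get i = true) :
    IsDisjRefuterAgainst Fu2020.Trivial.rejectAll C :=
  Filter.Eventually.frequently
    (h.mono fun _ hk => disjFailsOn_rejectAll (disjAnswer_of_all_true hk.1 hk.2))

/-! ### Proved: calibration — no refuter against the store-everything algorithm, which is in the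
class for fast `f` (rendering note (vi)) -/

/-- The deterministic one-pass algorithm storing the whole prefix and answering `DISJ` exactly at
the end. [folklore] -/
def storeAll : Fu2020.RStreamingAlgorithm where
  updCoins _ := 0
  repCoins _ := 0
  update _ st b _ := st ++ [b]
  accept _ st _ := disjAnswer st

/-- `storeAll` stores exactly the prefix read so far. [folklore] -/
@[simp] theorem reach_storeAll (N : ℕ) (x y : List Bool) : storeAll.reach N x y = x := by
  induction x using List.reverseRecOn with
  | nil => rfl
  | append_singleton x b ih =>
    rw [Fu2020.RStreamingAlgorithm.reach_append_singleton, ih]; rfl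

/-- `storeAll` answers `DISJ` correctly under every coin string. [folklore] -/
@[simp] theorem acceptsWith_storeAll (w y : List Bool) :
    storeAll.acceptsWith w y = disjAnswer w := by
  show storeAll.accept w.length (storeAll.reach w.length w y) (storeAll.repCoinsOf w.length y) =
    disjAnswer w
  rw [reach_storeAll]
  rfl

/-- `storeAll` decides `DISJ` (with no error at all). [folklore] -/
theorem storeAll_decidesBP : storeAll.DecidesBP DISJ := by
  intro w
  have hset : {y : List Bool | storeAll.acceptsWith w y = true ↔ w ∈ DISJ} = Set.univ := by
    ext y
    simp only [acceptsWith_storeAll, mem_DISJ, Set.mem_setOf_eq, Set.mem_univ]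
  rw [hset, uniformProb_univ]
  norm_num

/-- `storeAll` fails on no stream. [folklore] -/
theorem not_disjFailsOn_storeAll (w : List Bool) : ¬ DisjFailsOn storeAll w := by
  unfold DisjFailsOn
  have hset : {y : List Bool | storeAll.acceptsWith w y = disjAnswer w} = Set.univ := by
    ext y
    simp
  rw [hset, uniformProb_univ]
  norm_num

/-- **No family refutes `storeAll`** (in particular no uniform `AC⁰` one). [folklore] -/
theorem not_hasDisjAC0Refuter_storeAll : ¬ HasDisjAC0Refuter storeAll := by
  rintro ⟨_, C, _, hC⟩
  obtain ⟨k, hk⟩ := hC.exists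
  exact not_disjFailsOn_storeAll _ hk

/-- **`storeAll` is in the class for fast `f`**: if `(log₂ N)^{f(N)} ≥ N` for all large `N`, the
linear space of `storeAll` is within `c · (log₂ N)^{f(N)} + c`. [folklore] -/
theorem storeAll_mem {f : ℕ → ℕ} (hf : ∀ᶠ N in atTop, N ≤ Nat.log 2 N ^ f N) :
    storeAll ∈ PolylogSpaceStreaming f := by
  obtain ⟨N₀, hN₀⟩ := Filter.eventually_atTop.1 hf
  refine ⟨N₀ + 1, fun N x y hx _ => ?_⟩
  rw [reach_storeAll]
  show x.length ≤ (N₀ + 1) * Nat.log 2 N ^ f N + (N₀ + 1)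
  rcases Nat.lt_or_ge N N₀ with h | h
  · omega
  · have := hN₀ N h
    nlinarith

/-- **Calibration**: for such fast `f` the hypothesis of `thm14` is FALSE (the class contains an
exact algorithm), so those instances of Thm. 1.4 are vacuous; its content lies in the regime
`(log N)^{f(N)} < N` infinitely often. [folklore] -/
theorem not_forall_hasDisjAC0Refuter_of_fast {f : ℕ → ℕ}
    (hf : ∀ᶠ N in atTop, N ≤ Nat.log 2 N ^ f N) :
    ¬ ∀ A ∈ PolylogSpaceStreaming f, HasDisjAC0Refuter A :=
  fun h => not_hasDisjAC0Refuter_storeAll (h _ (storeAll_mem hf))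

/-- **Consumer form of `thm14`.** [cite: ChenEtAl2022, Thm. 1.4] -/
theorem P_ne_NP_of_thm14 (hT : thm14) {f : ℕ → ℕ} (hf : Tendsto f atTop atTop)
    (h : ∀ A ∈ PolylogSpaceStreaming f, HasDisjAC0Refuter A) :
    Classes.P ≠ Nondeterministic.NP :=
  hT f hf h

end Literature.Computability.MetaComplexity.ChenJinSanthanamWilliams2022

end
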